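import Summits.SmoothPoincare4.SmoothPoincare4.Theorems.DottedCircleRasmussenDcrGapHelperFriendsCarrierVkPartAPartIPicture
import Summits.SmoothPoincare4.SmoothPoincare4.Theorems.DottedCircleRasmussenDcrGapHelperFriendsCarrierVkPartATubeLoops
import Literature.Topology.FourManifolds.DehnSurgeryHomology

/-!
# Helper `helper_friendsCarrier_Vk_partA_partI` (V_k part A, part I: the tube framing is the Seifert
framing), piece 2: the collar of the picture about an inner core circle
(line `mk_friends`, crux `DcrGap`; item stmt-SmoothPoincare4-16128, route route-SmoothPoincare4-DottedCircleRasmussen)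

For `0 < ε ≤ 1/40` and a hole `c_j` of the planar domain, the picture `W_j = P(M_k ∩ {0 < |w|² < ε} ∩ {|z − c_j| < 27/20})`
of the punctured tube about the `j`-th inner core circle of the model boundary `M_k` is homeomorphic to
`𝕊¹ × (D̊² ∖ 0)`: the core straightening map `Θᴬ(z, w) = ((g(z) + |w|²) u_{c_j}(z), w)` of the tree
(`MMSW.ΘAin`, `MMSWPictureRadialCollar`/`…SectionsCore`) restricted to `M_k = {g + |w|² = 1}` is
`(u_{c_j}(z), w)`, a homeomorphism onto `𝕊¹ × {0 < |w|² < ε}` with the smooth inverse `invFunOn Θᴬ`.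
Consequently (`surgeryModel.exists_eq_zsmul_add_zsmul` of `DehnSurgeryHomology.lean`, degree-one Künneth)
`H₁(W_j; ℤ)` is generated by the Hurewicz classes of two explicit loops: the core-parallel loop `A_j`
(`u_{c_j}(z) = e^{2πit}`, `w = √ε/2`) and the fibre circle `B_j` (`z = z₁`, `w = (√ε/2) e^{2πit}`).

* `FriendsCarrierVk.collarIn_*` — the straightening data;
* `helper_friendsCarrier_Vk_partA_partI_collarIn` — the registered statement.

No definitions, no named facts, no `sorry`.

## References

* R. Kirby, *The Topology of 4-Manifolds*, LNM 1374 (1989), Ch. I §2. [Kirby1989]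
* A. Hatcher, *Algebraic Topology*, CUP (2002), §3.B (Künneth in degree one), Thm. 2A.1. [HatcherAT2002]
-/

set_option linter.dupNamespace false
set_option linter.style.longLine false

noncomputable section

open scoped Manifold ContDiff Topology ComplexConjugate
open Function Set Metric TopologicalSpace Literature.Topology.FourManifolds Literature.Topology.FourManifolds.MMSW Literature.AlgebraicTopology.Homotopy.HopfFibration
  Literature.AlgebraicTopology.SingularHomology

namespace Summit.SmoothPoincare4.SmoothPoincare4.Theorems.DcrGap.MkFriends

namespace FriendsCarrierVk

variable {k : ℕ} {ε : ℝ} {j : Fin k}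

/-! ## The straightening data of an inner core collar -/

/-- `toC` of the standard circle point is `e^{2πit}`. [folklore] -/
theorem collar_toC_circlePoint (t : ℝ) :
    toC ((circlePoint (2 * Real.pi * t) : sphere (0 : EuclideanSpace ℝ (Fin 2)) 1) : EuclideanSpace ℝ (Fin 2)) =
      Complex.exp ((2 * Real.pi * t : ℝ) * Complex.I) := by
  rw [← circlePt_eq_circlePoint, toC_circlePt, Circle.coe_exp]

/-- `toC` of the base circle point is `1`. [folklore] -/
theorem collar_toC_circlePoint_zero :
    toC ((circlePoint 0 : sphere (0 : EuclideanSpace ℝ (Fin 2)) 1) : EuclideanSpace ℝ (Fin 2)) = 1 := by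
  have := collar_toC_circlePoint 0
  rw [mul_zero] at this
  rw [this]; simp

/-- **Every point `(e, w)`, `|e| = 1`, `|w|² < 1/40`, is a straightened point of the inner collar**
(`r₁ = 1`, where `g ≥ 1`, and the far endpoint of the tree, where `g < 24/25`). [folklore] -/
theorem collarIn_mem_image (j : Fin k) {e w : ℂ} (he : ‖e‖ = 1) (hw : ‖w‖ ^ 2 < 1 / 40) :
    (e, w) ∈ ΘAin k j '' CAin k j := by
  obtain ⟨n₂, hn₂, hn₂', hg₂⟩ := exists_far_endpoint j he
  have hw5 : ‖w‖ < 1 / 5 := by nlinarith [norm_nonneg w]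
  refine mem_image_thetaA_of_ivt (by norm_num) (inner_radial j) he hw5 (r₁ := 1) (by norm_num) (by linarith) hn₂' ?_ ?_
  · have hne : holeCentre k j + ((1 : ℝ) : ℂ) * e ≠ holeCentre k j := by
      intro h
      have : ((1 : ℝ) : ℂ) * e = 0 := by simpa using congrArg (· - holeCentre k j) h
      rw [Complex.ofReal_one, one_mul] at this
      rw [this, norm_zero] at he; exact zero_ne_one he
    have h1 := one_le_planarPot_of_norm_le_one hne (by rw [add_sub_cancel_left, norm_mul, Complex.norm_real, he, mul_one]; simp)
    nlinarith [norm_nonneg w]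
  · nlinarith [norm_nonneg w]

/-- **The inverse straightening of `(e, w)`** (`|e| = 1`, `|w|² < 1/40`): a point `(z, w)` of the collar on
the level `g(z) + |w|² = 1` with `u_{c_j}(z) = e`. [folklore] -/
theorem collarIn_psi_spec (j : Fin k) {e w : ℂ} (he : ‖e‖ = 1) (hw : ‖w‖ ^ 2 < 1 / 40) :
    (invFunOn (ΘAin k j) (CAin k j) (e, w)).1 ∈ annulus (holeCentre k j) (1 / 2) (27 / 20) ∧
      (invFunOn (ΘAin k j) (CAin k j) (e, w)).2 = w ∧
      planarPot k (invFunOn (ΘAin k j) (CAin k j) (e, w)).1 + ‖w‖ ^ 2 = 1 ∧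
      unitDir (holeCentre k j) (invFunOn (ΘAin k j) (CAin k j) (e, w)).1 = e := by
  have himg := collarIn_mem_image j he hw
  set p := invFunOn (ΘAin k j) (CAin k j) (e, w) with hp
  have hpmem : p ∈ CAin k j := invFunOn_thetaA_mem himg
  have hΘ : ΘAin k j p = (e, w) := thetaA_invFunOn himg
  have hz : p.1 ∈ annulus (holeCentre k j) (1 / 2) (27 / 20) := hpmem.1
  have h2 : p.2 = w := congrArg Prod.snd hΘ
  have hlev : planarPot k p.1 + ‖p.2‖ ^ 2 = 1 := by
    rw [level_iff_norm_thetaA_fst (c := holeCentre k j) (a₂ := (27 : ℝ) / 20) (by norm_num) (inner_pos j) hz]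
    show ‖(ΘAin k j p).1‖ = 1
    rw [hΘ]; exact he
  have hu : unitDir (holeCentre k j) p.1 = e := by
    have h1 := thetaA_of_level (c := holeCentre k j) hlev
    rw [← ΘAin, hΘ] at h1
    exact (congrArg Prod.fst h1).symm
  rw [h2] at hlev
  exact ⟨hz, h2, hlev, hu⟩

/-- The model point of the inverse straightening lies on `M_k`, in the punctured `ε`-tube about the `j`-th
core, strictly outside the unit circle about `c_j`. [folklore] -/
theorem collarIn_point_spec (j : Fin k) (hε : ε ≤ 1 / 40) {e w : ℂ} (he : ‖e‖ = 1) (hw0 : w ≠ 0) (hw : ‖w‖ ^ 2 < ε) :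
    ofZW (invFunOn (ΘAin k j) (CAin k j) (e, w)).1 w ∈ modelBoundary k ∧
      1 < ‖(invFunOn (ΘAin k j) (CAin k j) (e, w)).1 - holeCentre k j‖ ∧
      ‖(invFunOn (ΘAin k j) (CAin k j) (e, w)).1 - holeCentre k j‖ < 27 / 20 := by
  obtain ⟨hz, -, hlev, -⟩ := collarIn_psi_spec j he (lt_of_lt_of_le hw hε)
  set z := (invFunOn (ΘAin k j) (CAin k j) (e, w)).1 with hzdef
  have hM : (z, w) ∈ Mset k := mem_Mset_of_level_annulus hz hlev
  refine ⟨?_, ?_, hz.2⟩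
  · rw [← mem_Mset_iff]; simpa using hM
  · by_contra hle
    push Not at hle
    have h1 := one_le_planarPot_of_norm_le_one (ne_centre_of_mem_annulus (by norm_num) hz) hle
    have : 0 < ‖w‖ ^ 2 := by positivity
    linarith

/-- **The straightening inverts on `M_k`**: for a point `(z, w)` of the collar on the level,
`invFunOn Θᴬ (u_{c_j}(z), w) = (z, w)`. [folklore] -/
theorem collarIn_psi_theta (j : Fin k) {z w : ℂ} (hz : z ∈ annulus (holeCentre k j) (1 / 2) (27 / 20))
    (hw : ‖w‖ < 1 / 5) (hlev : planarPot k z + ‖w‖ ^ 2 = 1) :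
    invFunOn (ΘAin k j) (CAin k j) (unitDir (holeCentre k j) z, w) = (z, w) := by
  have h1 : ΘAin k j (z, w) = (unitDir (holeCentre k j) z, w) := thetaA_of_level (p := (z, w)) hlev
  rw [← h1]
  exact invFunOn_thetaA (by norm_num) (inner_pos j) (inner_radial j) ⟨hz, hw⟩

/-- The chart lift of a point of `W_j`: a point of `M_k` in the punctured `ε`-tube near `c_j` whose picture
is the point. [folklore] -/
theorem collarIn_lift_spec {y : sphere (0 : EuclideanSpace ℝ (Fin 4)) 1}
    (hy : y ∈ (fun x : EuclideanSpace ℝ (Fin 4) => stereoNorthInv (draw k x)) ''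
      {x | x ∈ modelBoundary k ∧ wC x ≠ 0 ∧ ‖wC x‖ ^ 2 < ε ∧ ‖zC x - holeCentre k j‖ < 27 / 20}) :
    chartLift k (stereoNorthCoords (y : EuclideanSpace ℝ (Fin 4))) ∈ modelBoundary k ∧
      wC (chartLift k (stereoNorthCoords (y : EuclideanSpace ℝ (Fin 4)))) ≠ 0 ∧
      ‖wC (chartLift k (stereoNorthCoords (y : EuclideanSpace ℝ (Fin 4))))‖ ^ 2 < ε ∧
      1 < ‖zC (chartLift k (stereoNorthCoords (y : EuclideanSpace ℝ (Fin 4)))) - holeCentre k j‖ ∧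
      ‖zC (chartLift k (stereoNorthCoords (y : EuclideanSpace ℝ (Fin 4)))) - holeCentre k j‖ < 27 / 20 ∧
      stereoNorthInv (draw k (chartLift k (stereoNorthCoords (y : EuclideanSpace ℝ (Fin 4))))) = y := by
  obtain ⟨x, ⟨hx, hw, hwε, hnear⟩, rfl⟩ := hy
  rw [pic_lift_P hx hw]
  refine ⟨hx, hw, hwε, ?_, hnear, rfl⟩
  have hreg := draw_mem_pictureRegion hx hw
  have h1 := hreg.2.1 j
  rw [chartZ_draw hx hw, Complex.normSq_eq_norm_sq] at h1
  nlinarith [norm_nonneg (zC x - holeCentre k j)]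

/-- `W_j` lies in the picture of `M_k ∖ {cores}`. [folklore] -/
theorem collarIn_subset :
    (fun x : EuclideanSpace ℝ (Fin 4) => stereoNorthInv (draw k x)) ''
      {x | x ∈ modelBoundary k ∧ wC x ≠ 0 ∧ ‖wC x‖ ^ 2 < ε ∧ ‖zC x - holeCentre k j‖ < 27 / 20} ⊆
    (fun x : EuclideanSpace ℝ (Fin 4) => stereoNorthInv (draw k x)) '' {x | x ∈ modelBoundary k ∧ wC x ≠ 0} :=
  image_mono fun _ hx => ⟨hx.1, hx.2.1⟩

/-- The direction of `z − c_j` is continuous off the pole. [folklore] -/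
theorem collarIn_continuousAt_holeDirS {z : ℂ} (hz : z ≠ holeCentre k j) : ContinuousAt (holeDirS k j) z := by
  have h0 : toE2 (z - holeCentre k j) ≠ 0 := by rw [Ne, toE2_eq_zero_iff, sub_eq_zero]; exact hz
  have h1 : ContinuousAt (fun z : ℂ => toE2 (z - holeCentre k j)) z :=
    (contDiff_toE2.continuous.comp (continuous_id.sub continuous_const)).continuousAt
  exact ContinuousAt.comp (x := z) ((continuousOn_radialProjection _).continuousAt (isOpen_ne.mem_nhds h0)) h1

end FriendsCarrierVk

open FriendsCarrierVk in
/-- **Piece 2 of part I of V_k part A: the inner core collar of the picture is a thickened torus whose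
first homology is generated by the core-parallel loop and the fibre circle.**  For `0 < ε ≤ 1/40` and a
hole `j`, on `W_j = P(M_k ∩ {0 < |w|² < ε} ∩ {|z − c_j| < 27/20})` there are loops `A`, `B` with
`A(t) = P(z_t, √ε/2)`, `u_{c_j}(z_t) = e^{2πit}`, and `B(t) = P(z₁, (√ε/2) e^{2πit})`, such that every class of
`H₁(W_j; ℤ)` is `a • h(A) + b • h(B)`. [cite: HatcherAT2002, §3.B] -/
theorem helper_friendsCarrier_Vk_partA_partI_collarIn : ∀ (k : ℕ) (ε : ℝ) (j : Fin k), 0 < ε → ε ≤ 1 / 40 → ∀ (Wj : Set (sphere (0 : EuclideanSpace ℝ (Fin 4)) 1)), Wj = (fun x : EuclideanSpace ℝ (Fin 4) => stereoNorthInv (draw k x)) '' {x | x ∈ modelBoundary k ∧ wC x ≠ 0 ∧ ‖wC x‖ ^ 2 < ε ∧ ‖zC x - holeCentre k j‖ < 27 / 20} → ∃ (p : ↥Wj) (A B : Path p p), (∀ t : unitInterval, ∃ z : ℂ, 1 < ‖z - holeCentre k j‖ ∧ ‖z - holeCentre k j‖ < 27 / 20 ∧ unitDir (holeCentre k j) z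 = Complex.exp ((2 * Real.pi * t : ℝ) * Complex.I) ∧ ofZW z ((Real.sqrt ε / 2 : ℝ) : ℂ) ∈ modelBoundary k ∧ ((A t : ↥Wj) : sphere (0 : EuclideanSpace ℝ (Fin 4)) 1) = stereoNorthInv (draw k (ofZW z ((Real.sqrt ε / 2 : ℝ) : ℂ)))) ∧ (∃ z₁ : ℂ, 1 < ‖z₁ - holeCentre k j‖ ∧ ‖z₁ - holeCentre k j‖ < 27 / 20 ∧ ∀ t : unitInterval, ofZW z₁ (((Real.sqrt ε / 2 : ℝ) : ℂ) * Complex.exp ((2 * Real.pi * t : ℝ) * Complex.I)) ∈ modelBoundary k ∧ ((B t : ↥Wj) : sphere (0 : EuclideanSpace ℝ (Fin 4)) 1) = stereoNorthInv (draw k (ofZW z₁ (((Real.sqrt ε / 2 : ℝ) : ℂ) * Complex.exp ((2 * Real.pi * t : ℝ) * Complex.I))))) ∧ ∀ d : singularHomology ℤ ℤ ↥Wj 1, ∃ a b : ℤ, d = a • loopClass ℤ ℤ (1 : ℤ) A + b • loopClass ℤ ℤ (1 : ℤ) B := by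
  intro k ε j hε hε' Wj hWj
  have hsε : 0 < Real.sqrt ε := Real.sqrt_pos.2 hε
  have hsε2 : Real.sqrt ε ^ 2 = ε := Real.sq_sqrt hε.le
  -- the straightened coordinates of a point of `W_j`
  have hspec : ∀ y : ↥Wj, chartLift k (stereoNorthCoords ((y : sphere (0 : EuclideanSpace ℝ (Fin 4)) 1) : EuclideanSpace ℝ (Fin 4))) ∈ modelBoundary k ∧
      wC (chartLift k (stereoNorthCoords ((y : sphere (0 : EuclideanSpace ℝ (Fin 4)) 1) : EuclideanSpace ℝ (Fin 4)))) ≠ 0 ∧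
      ‖wC (chartLift k (stereoNorthCoords ((y : sphere (0 : EuclideanSpace ℝ (Fin 4)) 1) : EuclideanSpace ℝ (Fin 4))))‖ ^ 2 < ε ∧
      1 < ‖zC (chartLift k (stereoNorthCoords ((y : sphere (0 : EuclideanSpace ℝ (Fin 4)) 1) : EuclideanSpace ℝ (Fin 4)))) - holeCentre k j‖ ∧
      ‖zC (chartLift k (stereoNorthCoords ((y : sphere (0 : EuclideanSpace ℝ (Fin 4)) 1) : EuclideanSpace ℝ (Fin 4)))) - holeCentre k j‖ < 27 / 20 ∧
      stereoNorthInv (draw k (chartLift k (stereoNorthCoords ((y : sphere (0 : EuclideanSpace ℝ (Fin 4)) 1) : EuclideanSpace ℝ (Fin 4))))) = y :=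
    fun y => collarIn_lift_spec (hWj ▸ y.2)
  -- the forward map
  set f : ↥Wj → (sphere (0 : EuclideanSpace ℝ (Fin 2)) 1) × ↥puncturedDisc := fun y =>
    (holeDirS k j (zC (chartLift k (stereoNorthCoords ((y : sphere (0 : EuclideanSpace ℝ (Fin 4)) 1) : EuclideanSpace ℝ (Fin 4))))),
      ⟨(Real.sqrt ε)⁻¹ • toE2 (wC (chartLift k (stereoNorthCoords ((y : sphere (0 : EuclideanSpace ℝ (Fin 4)) 1) : EuclideanSpace ℝ (Fin 4))))),
        ⟨by
          rw [Ne, smul_eq_zero, not_or, toE2_eq_zero_iff]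
          exact ⟨inv_ne_zero hsε.ne', (hspec y).2.1⟩, by
          rw [norm_smul, norm_inv, Real.norm_of_nonneg hsε.le, norm_toE2]
          rw [inv_mul_lt_iff₀ hsε, mul_one]
          have h3 := (hspec y).2.2.1
          by_contra hle; push Not at hle
          nlinarith [norm_nonneg (wC (chartLift k (stereoNorthCoords ((y : sphere (0 : EuclideanSpace ℝ (Fin 4)) 1) : EuclideanSpace ℝ (Fin 4)))))]⟩⟩) with hf
  -- the backward map
  have hew : ∀ q : (sphere (0 : EuclideanSpace ℝ (Fin 2)) 1) × ↥puncturedDisc,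
      ‖toC (q.1 : EuclideanSpace ℝ (Fin 2))‖ = 1 ∧ ((Real.sqrt ε : ℝ) : ℂ) * toC (q.2 : EuclideanSpace ℝ (Fin 2)) ≠ 0 ∧
        ‖((Real.sqrt ε : ℝ) : ℂ) * toC (q.2 : EuclideanSpace ℝ (Fin 2))‖ ^ 2 < ε := by
    intro q
    have hv0 : toC (q.2 : EuclideanSpace ℝ (Fin 2)) ≠ 0 := by
      rw [← norm_ne_zero_iff, norm_toC, norm_ne_zero_iff]; exact q.2.2.1
    refine ⟨norm_toC_sphere _, mul_ne_zero (by exact_mod_cast hsε.ne') hv0, ?_⟩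
    rw [norm_mul, Complex.norm_real, Real.norm_of_nonneg hsε.le, norm_toC, mul_pow, hsε2]
    have h1 : ‖(q.2 : EuclideanSpace ℝ (Fin 2))‖ < 1 := q.2.2.2
    have h0 : 0 ≤ ‖(q.2 : EuclideanSpace ℝ (Fin 2))‖ := norm_nonneg _
    have h2 : ‖(q.2 : EuclideanSpace ℝ (Fin 2))‖ ^ 2 < 1 := by nlinarith
    calc ε * ‖(q.2 : EuclideanSpace ℝ (Fin 2))‖ ^ 2 < ε * 1 := mul_lt_mul_of_pos_left h2 hε
      _ = ε := mul_one ε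
  set g : (sphere (0 : EuclideanSpace ℝ (Fin 2)) 1) × ↥puncturedDisc → ↥Wj := fun q =>
    ⟨stereoNorthInv (draw k (ofZW (invFunOn (ΘAin k j) (CAin k j) (toC (q.1 : EuclideanSpace ℝ (Fin 2)),
        ((Real.sqrt ε : ℝ) : ℂ) * toC (q.2 : EuclideanSpace ℝ (Fin 2)))).1 (((Real.sqrt ε : ℝ) : ℂ) * toC (q.2 : EuclideanSpace ℝ (Fin 2))))), by
      rw [hWj]
      obtain ⟨hM, h1, h27⟩ := collarIn_point_spec j hε' (hew q).1 (hew q).2.1 (hew q).2.2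
      exact ⟨_, ⟨hM, by rw [wC_ofZW]; exact (hew q).2.1, by rw [wC_ofZW]; exact (hew q).2.2, by rw [zC_ofZW]; exact h27⟩, rfl⟩⟩ with hg
  have hgval : ∀ q, ((g q : ↥Wj) : sphere (0 : EuclideanSpace ℝ (Fin 4)) 1) =
      stereoNorthInv (draw k (ofZW (invFunOn (ΘAin k j) (CAin k j) (toC (q.1 : EuclideanSpace ℝ (Fin 2)),
        ((Real.sqrt ε : ℝ) : ℂ) * toC (q.2 : EuclideanSpace ℝ (Fin 2)))).1 (((Real.sqrt ε : ℝ) : ℂ) * toC (q.2 : EuclideanSpace ℝ (Fin 2))))) :=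
    fun q => rfl
  have hfval1 : ∀ y, (f y).1 = holeDirS k j (zC (chartLift k (stereoNorthCoords ((y : sphere (0 : EuclideanSpace ℝ (Fin 4)) 1) : EuclideanSpace ℝ (Fin 4))))) :=
    fun y => rfl
  have hfval2 : ∀ y, ((f y).2 : EuclideanSpace ℝ (Fin 2)) = (Real.sqrt ε)⁻¹ • toE2 (wC (chartLift k (stereoNorthCoords ((y : sphere (0 : EuclideanSpace ℝ (Fin 4)) 1) : EuclideanSpace ℝ (Fin 4))))) :=
    fun y => rfl
  -- `g ∘ f = id`
  have hgf : ∀ y, g (f y) = y := by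
    intro y
    obtain ⟨hM, hw0, hwε, h1, h27, hP⟩ := hspec y
    set x := chartLift k (stereoNorthCoords ((y : sphere (0 : EuclideanSpace ℝ (Fin 4)) 1) : EuclideanSpace ℝ (Fin 4))) with hx
    have hzc : zC x ≠ holeCentre k j := by
      intro h; rw [h, sub_self, norm_zero] at h1; linarith
    have he : toC ((f y).1 : EuclideanSpace ℝ (Fin 2)) = unitDir (holeCentre k j) (zC x) := by
      rw [hfval1, coe_holeDirS hzc, toC_toE2]
    have hw : ((Real.sqrt ε : ℝ) : ℂ) * toC ((f y).2 : EuclideanSpace ℝ (Fin 2)) = wC x := by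
      rw [hfval2, toC_smul, toC_toE2, ← mul_assoc]
      push_cast
      rw [mul_inv_cancel₀ (by exact_mod_cast hsε.ne'), one_mul]
    have hw5 : ‖wC x‖ < 1 / 5 := by nlinarith [norm_nonneg (wC x)]
    have hlev : planarPot k (zC x) + ‖wC x‖ ^ 2 = 1 := by
      have := hM.2
      rw [levelFun_eq_planarPot_add, Complex.normSq_eq_norm_sq] at this
      exact this
    apply Subtype.ext
    rw [hgval, he, hw, collarIn_psi_theta j ⟨by linarith, h27⟩ hw5 hlev]
    simp only [ofZW_zC_wC]
    exact hP
  -- `f ∘ g = id`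
  have hfg : ∀ q, f (g q) = q := by
    intro q
    obtain ⟨he1, hw0, hwε⟩ := hew q
    have hw40 : ‖((Real.sqrt ε : ℝ) : ℂ) * toC (q.2 : EuclideanSpace ℝ (Fin 2))‖ ^ 2 < 1 / 40 := lt_of_lt_of_le hwε hε'
    obtain ⟨hz, -, -, hu⟩ := collarIn_psi_spec j he1 hw40
    obtain ⟨hM, h1, -⟩ := collarIn_point_spec j hε' he1 hw0 hwε
    set p := invFunOn (ΘAin k j) (CAin k j) (toC (q.1 : EuclideanSpace ℝ (Fin 2)),
      ((Real.sqrt ε : ℝ) : ℂ) * toC (q.2 : EuclideanSpace ℝ (Fin 2))) with hp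
    have hxw : wC (ofZW p.1 (((Real.sqrt ε : ℝ) : ℂ) * toC (q.2 : EuclideanSpace ℝ (Fin 2)))) ≠ 0 := by
      rw [wC_ofZW]; exact hw0
    have hlift : chartLift k (stereoNorthCoords (((g q : ↥Wj) : sphere (0 : EuclideanSpace ℝ (Fin 4)) 1) : EuclideanSpace ℝ (Fin 4))) =
        ofZW p.1 (((Real.sqrt ε : ℝ) : ℂ) * toC (q.2 : EuclideanSpace ℝ (Fin 2))) := by
      rw [hgval, pic_lift_P hM hxw]
    have hzc : p.1 ≠ holeCentre k j := by
      intro h; rw [h, sub_self, norm_zero] at h1; linarith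
    refine Prod.ext ?_ (Subtype.ext ?_)
    · rw [hfval1, hlift, zC_ofZW]
      exact holeDirS_eq_of_unitDir_eq hzc hu
    · rw [hfval2, hlift, wC_ofZW, toE2_real_mul, toE2_toC, smul_smul, inv_mul_cancel₀ hsε.ne', one_smul]
  -- continuity of `f`
  have hWV : Wj ⊆ (fun x : EuclideanSpace ℝ (Fin 4) => stereoNorthInv (draw k x)) '' {x | x ∈ modelBoundary k ∧ wC x ≠ 0} := by
    rw [hWj]; exact collarIn_subset
  have hliftc : Continuous fun y : ↥Wj => chartLift k (stereoNorthCoords ((y : sphere (0 : EuclideanSpace ℝ (Fin 4)) 1) : EuclideanSpace ℝ (Fin 4))) :=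
    pic_continuousOn_lift.comp_continuous continuous_subtype_val fun y => hWV y.2
  have hfc : Continuous f := by
    refine Continuous.prodMk ?_ (Continuous.subtype_mk ?_ _)
    · refine continuous_iff_continuousAt.2 fun y => ?_
      have h1 := (hspec y).2.2.2.1
      have hzc : zC (chartLift k (stereoNorthCoords ((y : sphere (0 : EuclideanSpace ℝ (Fin 4)) 1) : EuclideanSpace ℝ (Fin 4)))) ≠ holeCentre k j := by
        intro h; rw [h, sub_self, norm_zero] at h1; linarith
      exact ContinuousAt.comp (g := holeDirS k j)
        (f := fun y : ↥Wj => zC (chartLift k (stereoNorthCoords ((y : sphere (0 : EuclideanSpace ℝ (Fin 4)) 1) : EuclideanSpace ℝ (Fin 4)))))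
        (x := y) (collarIn_continuousAt_holeDirS hzc) (continuous_zC.comp hliftc).continuousAt
    · exact (continuous_const (y := (Real.sqrt ε)⁻¹)).smul (contDiff_toE2.continuous.comp (continuous_wC.comp hliftc))
  -- continuity of `g`
  have hgc : Continuous g := by
    refine Continuous.subtype_mk ?_ _
    have hqc : Continuous fun q : (sphere (0 : EuclideanSpace ℝ (Fin 2)) 1) × ↥puncturedDisc =>
        (toC (q.1 : EuclideanSpace ℝ (Fin 2)), ((Real.sqrt ε : ℝ) : ℂ) * toC (q.2 : EuclideanSpace ℝ (Fin 2))) :=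
      (contDiff_toC.continuous.comp (continuous_subtype_val.comp continuous_fst)).prodMk
        (continuous_const.mul (contDiff_toC.continuous.comp (continuous_subtype_val.comp continuous_snd)))
    have hΨc : Continuous fun q : (sphere (0 : EuclideanSpace ℝ (Fin 2)) 1) × ↥puncturedDisc =>
        invFunOn (ΘAin k j) (CAin k j) (toC (q.1 : EuclideanSpace ℝ (Fin 2)), ((Real.sqrt ε : ℝ) : ℂ) * toC (q.2 : EuclideanSpace ℝ (Fin 2))) :=
      (ΘAin_straighten j).2.continuousOn.comp_continuous hqc fun q =>
        collarIn_mem_image j (hew q).1 (lt_of_lt_of_le (hew q).2.2 hε')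
    have hxc : Continuous fun q : (sphere (0 : EuclideanSpace ℝ (Fin 2)) 1) × ↥puncturedDisc =>
        ofZW (invFunOn (ΘAin k j) (CAin k j) (toC (q.1 : EuclideanSpace ℝ (Fin 2)),
          ((Real.sqrt ε : ℝ) : ℂ) * toC (q.2 : EuclideanSpace ℝ (Fin 2)))).1 (((Real.sqrt ε : ℝ) : ℂ) * toC (q.2 : EuclideanSpace ℝ (Fin 2))) :=
      continuous_ofZW.comp ((continuous_fst.comp hΨc).prodMk (continuous_snd.comp hqc))
    exact pic_continuousOn_P.comp_continuous hxc fun q => by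
      show wC _ ≠ 0
      rw [wC_ofZW]; exact (hew q).2.1
  -- the homeomorphism and the generators
  let h : ↥Wj ≃ₜ (sphere (0 : EuclideanSpace ℝ (Fin 2)) 1) × ↥puncturedDisc :=
    { toFun := f, invFun := g, left_inv := hgf, right_inv := hfg, continuous_toFun := hfc, continuous_invFun := hgc }
  refine ⟨g surgeryModel.base, surgeryModel.lonLoop.map hgc, surgeryModel.merLoop.map hgc, ?_, ?_, ?_⟩
  · intro t
    set q : (sphere (0 : EuclideanSpace ℝ (Fin 2)) 1) × ↥puncturedDisc := surgeryModel.lonLoop t with hq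
    have hq1 : toC (q.1 : EuclideanSpace ℝ (Fin 2)) = Complex.exp ((2 * Real.pi * t : ℝ) * Complex.I) := by
      rw [hq]; exact collar_toC_circlePoint t
    have hq2 : ((Real.sqrt ε : ℝ) : ℂ) * toC (q.2 : EuclideanSpace ℝ (Fin 2)) = ((Real.sqrt ε / 2 : ℝ) : ℂ) := by
      rw [hq]
      show ((Real.sqrt ε : ℝ) : ℂ) * toC (((puncturedDisc.half (circlePoint 0) : ↥puncturedDisc) : EuclideanSpace ℝ (Fin 2))) = _
      rw [puncturedDisc.coe_half_apply, toC_smul, collar_toC_circlePoint_zero]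
      push_cast; ring
    obtain ⟨he1, hw⟩ := hew q
    rw [hq1] at he1
    rw [hq2] at hw
    obtain ⟨hM, h1, h27⟩ := collarIn_point_spec j hε' he1 hw.1 hw.2
    obtain ⟨-, -, -, hu⟩ := collarIn_psi_spec j he1 (lt_of_lt_of_le hw.2 hε')
    refine ⟨_, h1, h27, hu, hM, ?_⟩
    rw [Path.map_coe, Function.comp_apply, ← hq, hgval, hq1, hq2]
  · have he1 : ‖(1 : ℂ)‖ = 1 := norm_one
    have hw1 : ((Real.sqrt ε / 2 : ℝ) : ℂ) ≠ 0 ∧ ‖((Real.sqrt ε / 2 : ℝ) : ℂ)‖ ^ 2 < ε := by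
      refine ⟨by exact_mod_cast (by positivity : Real.sqrt ε / 2 ≠ 0), ?_⟩
      rw [Complex.norm_real, Real.norm_of_nonneg (by positivity), div_pow, hsε2]; linarith
    obtain ⟨hM₁, h1, h27⟩ := collarIn_point_spec j hε' he1 hw1.1 hw1.2
    refine ⟨_, h1, h27, fun t => ?_⟩
    set q : (sphere (0 : EuclideanSpace ℝ (Fin 2)) 1) × ↥puncturedDisc := surgeryModel.merLoop t with hq
    have hq1 : toC (q.1 : EuclideanSpace ℝ (Fin 2)) = 1 := by rw [hq]; exact collar_toC_circlePoint_zero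
    have hq2 : ((Real.sqrt ε : ℝ) : ℂ) * toC (q.2 : EuclideanSpace ℝ (Fin 2)) =
        ((Real.sqrt ε / 2 : ℝ) : ℂ) * Complex.exp ((2 * Real.pi * t : ℝ) * Complex.I) := by
      rw [hq]
      show ((Real.sqrt ε : ℝ) : ℂ) * toC (((puncturedDisc.half (circlePoint (2 * Real.pi * t)) : ↥puncturedDisc) : EuclideanSpace ℝ (Fin 2))) = _
      rw [puncturedDisc.coe_half_apply, toC_smul, collar_toC_circlePoint]
      push_cast; ring
    have hn : ‖((Real.sqrt ε / 2 : ℝ) : ℂ) * Complex.exp ((2 * Real.pi * t : ℝ) * Complex.I)‖ = ‖((Real.sqrt ε / 2 : ℝ) : ℂ)‖ := by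
      rw [norm_mul, Complex.norm_exp_ofReal_mul_I, mul_one]
    obtain ⟨-, hwt⟩ := hew q
    rw [hq2] at hwt
    -- the `z`-component only depends on `|w|`
    have hz : (invFunOn (ΘAin k j) (CAin k j) (1, ((Real.sqrt ε / 2 : ℝ) : ℂ) * Complex.exp ((2 * Real.pi * t : ℝ) * Complex.I))).1 =
        (invFunOn (ΘAin k j) (CAin k j) (1, ((Real.sqrt ε / 2 : ℝ) : ℂ))).1 := by
      obtain ⟨hza, -, hleva, hua⟩ := collarIn_psi_spec j he1 (lt_of_lt_of_le hwt.2 hε')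
      obtain ⟨hzb, -, hlevb, hub⟩ := collarIn_psi_spec j he1 (lt_of_lt_of_le hw1.2 hε')
      rw [hn] at hleva
      have hw5 : ‖((Real.sqrt ε / 2 : ℝ) : ℂ)‖ < 1 / 5 := by
        have := lt_of_lt_of_le hw1.2 hε'; nlinarith [norm_nonneg (((Real.sqrt ε / 2 : ℝ) : ℂ))]
      have ea := collarIn_psi_theta j hza hw5 hleva
      have eb := collarIn_psi_theta j hzb hw5 hlevb
      rw [hua] at ea; rw [hub] at eb
      exact (Prod.ext_iff.1 (ea.symm.trans eb)).1
    obtain ⟨hMt, -, -⟩ := collarIn_point_spec j hε' he1 hwt.1 hwt.2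
    rw [hz] at hMt
    refine ⟨hMt, ?_⟩
    rw [Path.map_coe, Function.comp_apply, ← hq, hgval, hq1, hq2, hz]
  · intro d
    obtain ⟨i, i', hd⟩ := surgeryModel.exists_eq_zsmul_add_zsmul (singularHomology.map ℤ ℤ (h : C(↥Wj, (sphere (0 : EuclideanSpace ℝ (Fin 2)) 1) × ↥puncturedDisc)) 1 d)
    refine ⟨i, i', ?_⟩
    have hback : singularHomology.map ℤ ℤ (h.symm : C((sphere (0 : EuclideanSpace ℝ (Fin 2)) 1) × ↥puncturedDisc, ↥Wj)) 1 (singularHomology.map ℤ ℤ (h : C(↥Wj, (sphere (0 : EuclideanSpace ℝ (Fin 2)) 1) × ↥puncturedDisc)) 1 d) = d := by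
      rw [← ModuleCat.comp_apply, ← singularHomology.map_comp]
      rw [show (h.symm : C((sphere (0 : EuclideanSpace ℝ (Fin 2)) 1) × ↥puncturedDisc, ↥Wj)).comp (h : C(↥Wj, (sphere (0 : EuclideanSpace ℝ (Fin 2)) 1) × ↥puncturedDisc)) = ContinuousMap.id _ from by ext y : 1; exact h.symm_apply_apply y,
        singularHomology.map_id, ModuleCat.id_apply]
    rw [← hback, hd, map_add, map_zsmul, map_zsmul, map_loopClass, map_loopClass]
    rfl
end Summit.SmoothPoincare4.SmoothPoincare4.Theorems.DcrGap.MkFriends
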